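import Mathlib
import HarnessLib
import Summits.HubbardSuperconductivity.HubbardSuperconductivity.Theorems.KLProgrammeH10TwoPointLimitPerturbedFermiRadiusCurvature
import Summits.HubbardSuperconductivity.HubbardSuperconductivity.Theorems.KLProgrammeH10TwoPointLimitPerturbedFermiRadiusSecondOrderClose
import Summits.HubbardSuperconductivity.HubbardSuperconductivity.Theorems.KLProgrammeH10TwoPointLimitPerturbedNormalAngleLipschitz

/-!
# Route `KLProgramme` — ENGINE child (stmt-HubbardSuperconductivity-20437 `KLRegimeEngineV17F2`), T+ item (iv) of the (F)(i) re-framing recipe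
# (HOME/hubbard-kl-k3c2-p2/F-REFRAME-RECIPE.md §4): the GAUSS-MAP RATE of the PERTURBED Fermi curve is bounded BELOW — the `BandBounds.gauss`
# field `a_min·|θ − θ′| ≤ |α(θ) − α(θ′)|` ON THE MOVING CURVE, with explicit constants

Cell `gate-hubbard-kl`, seat hubbard-kl-k3c2-p2 g15 (row «thermal-bar induction n ≤ nScales β + 1 with EngineBoundsAtV4S sums»; class-#5 STEP sizes /
(F)(i) lane).  For a root selection `u` of the perturbed curve `{ε₀ + δ = μ}` (`δ ∈ C²`, `|δ| ≤ κ₀`, `‖Dδ‖ ≤ κ₁ < Dt_min`, `‖D²δ‖ ≤ κ₂` on the closed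
square, `[μ − κ₀, μ + κ₀] ⊂ [a, b]`, bundle `B : BandBounds a b`) the normal angle `α(θ) = θ − arctan(u′/u)` (p4's `…PerturbedNormalAngleLipschitz`,
which gives the UPPER bound `|α′| ≤ 2 + U₂/u_min`) has derivative
  `α′ = (u² + 2u′² − u·u″)/(u² + u′²)`  (`deriv_normalAngleFn_eq`)
— the polar-curvature numerator of `…PerturbedFermiRadiusCurvature` over the squared speed.  Hence:
* §2 INTRINSIC form: `α′ ≥ a_E := u_min(2h_E − κ₂S_E²)/((4 + κ₁)·2S_E²)` whenever `2h_E − κ₂S_E² ≥ 0` (`curvRate_le_deriv_normalAngleFn`, from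
  `curvatureNumerator_ge` + `deriv_sq_add_sq_le`), and the EXPANDING form `a_E·(θ′ − θ) ≤ α(θ′) − α(θ)` (`θ ≤ θ′`), `a_E·|θ − θ′| ≤ |α(θ) − α(θ′)|`
  (`normalAngleFn_expand_curv`) — `h_E = h_min − 4κ₁C_V(S_E + s_max)`, `S_E = s_max + κ₁C_V`, `C_V = (π√2 + 2s_max)/(Dt_min − κ₁)`;
* §3 CLOSENESS form (architecture (β): the free lemma at the shifted level + `O(κ)` slack): the free band's rate satisfies `a_min ≤ α_ν′(θ)` at every level
  `ν ∈ [a, b]` (`amin_le_bandNormalAngleDeriv`, the infinitesimal form of `BandBounds.gauss`), and at the shifted level `ν = μ − δ(u(θ)·dir θ)` the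
  perturbed rate is within
  `GAP := K₂/u_min + κ₁C_V(4S_E + κ₁C_V)(π√2 + U₂)/u_min³`
  of it (`abs_deriv_normalAngleFn_sub_bandNormalAngleDeriv_le`; `K₂` = the constant of `abs_second_deriv_sub_bandRadiusDeriv2_le`, `U₂` that of
  `abs_second_deriv_le`), so **`α′ ≥ a_min − GAP`** (`deriv_normalAngleFn_ge_amin_sub`) and **`(a_min − GAP)·|θ − θ′| ≤ |α(θ) − α(θ′)|`**
  (`normalAngleFn_expand`) — the «`ν′_min ≥ a_min − c(κ₁ + κ₂)`» of the recipe, `GAP = O(κ₁ + κ₂)` with `B`-explicit coefficients;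
* §4 the same in BGM 2003's chart vocabulary for `u := perturbedFermiRadius δ μ` (`normalAngle_perturbed_expand`).
USES.  (F)(i) two-soft-line constant `c₂′ = (1 + 4/d)(2 + 4/ν′_min)/16` (pen (R85a)); Cooper-regime transversality of the frame band's two-shell bound
(`TwoShellFrameAreaAt`, `…EngineV8DefsG11`): on the moving curve `f(θ) = e_K(p_K(θ) − w)` has `|f′| ≳ |∇e_K|·ν′_min·|w|` away from tangency.
Everything is PROVED; no definitions, no named facts; nothing about the model's sizes is asserted; nothing asserts superconductivity.
References: BGM 2003 §1.2 (2.8a), §7.1 Lemma 7.1 (A1.9)–(A1.10) [cite: BenfattoGiulianiMastropietro2003]; BGM 2006 §2.4 Lemma 2.1 (2.40)–(2.41)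
[cite: BenfattoGiulianiMastropietro2006].
-/

noncomputable section

namespace Summit.HubbardSuperconductivity.HubbardSuperconductivity.Theorems.PerturbedFermiCurve

set_option linter.dupNamespace false -- summit = problem name (single-conjunct summit), D-0017

open Real Set Filter Topology
open Literature.MathematicalPhysics.QuantumLattice Literature.MathematicalPhysics.QuantumLattice.BandSectorCounting
open Literature.MathematicalPhysics.QuantumLattice.FermiRG

/-! ## §1 Algebra of the rate `(u² + 2p² − u q)/(u² + p²)` -/

/-- `1 − ((q u − p p)/u²)/(1 + (p/u)²) = (u² + 2p² − u q)/(u² + p²)` for `u > 0`. [folklore] -/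
theorem one_sub_arctanDeriv_eq_rate {u p q : ℝ} (hu : 0 < u) :
    1 - (q * u - p * p) / u ^ 2 / (1 + (p / u) ^ 2) = (u ^ 2 + 2 * p ^ 2 - u * q) / (u ^ 2 + p ^ 2) := by
  have hden : 0 < u ^ 2 + p ^ 2 := by positivity
  field_simp
  ring

/-- **The rate is Lipschitz in `(u′, u″)` at fixed `u > 0`**:
`|(u² + 2p₁² − u q₁)/(u² + p₁²) − (u² + 2p₂² − u q₂)/(u² + p₂²)| ≤ |q₁ − q₂|/u + |p₁ − p₂|(|p₁| + |p₂|)(u + |q₁|)/u³`. [folklore] -/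
theorem abs_rate_sub_rate_le {u p₁ q₁ p₂ q₂ : ℝ} (hu : 0 < u) :
    |(u ^ 2 + 2 * p₁ ^ 2 - u * q₁) / (u ^ 2 + p₁ ^ 2) - (u ^ 2 + 2 * p₂ ^ 2 - u * q₂) / (u ^ 2 + p₂ ^ 2)| ≤
      |q₁ - q₂| / u + |p₁ - p₂| * (|p₁| + |p₂|) * (u + |q₁|) / u ^ 3 := by
  have hD1 : 0 < u ^ 2 + p₁ ^ 2 := by positivity
  have hD2 : 0 < u ^ 2 + p₂ ^ 2 := by positivity
  -- exact decomposition of the difference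
  have hdec : (u ^ 2 + 2 * p₁ ^ 2 - u * q₁) / (u ^ 2 + p₁ ^ 2) - (u ^ 2 + 2 * p₂ ^ 2 - u * q₂) / (u ^ 2 + p₂ ^ 2) =
      u * ((p₁ - p₂) * (p₁ + p₂) * (u + q₁)) / ((u ^ 2 + p₁ ^ 2) * (u ^ 2 + p₂ ^ 2)) - u * (q₁ - q₂) / (u ^ 2 + p₂ ^ 2) := by
    field_simp
    ring
  rw [hdec]
  have hA : |u * ((p₁ - p₂) * (p₁ + p₂) * (u + q₁)) / ((u ^ 2 + p₁ ^ 2) * (u ^ 2 + p₂ ^ 2))| ≤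
      |p₁ - p₂| * (|p₁| + |p₂|) * (u + |q₁|) / u ^ 3 := by
    rw [abs_div, abs_of_pos (mul_pos hD1 hD2), abs_mul, abs_of_pos hu, abs_mul, abs_mul]
    have h12 : |p₁ + p₂| ≤ |p₁| + |p₂| := abs_add_le _ _
    have huq : |u + q₁| ≤ u + |q₁| := (abs_add_le _ _).trans (by rw [abs_of_pos hu])
    have hnum : u * (|p₁ - p₂| * |p₁ + p₂| * |u + q₁|) ≤ u * (|p₁ - p₂| * (|p₁| + |p₂|) * (u + |q₁|)) := by
      refine mul_le_mul_of_nonneg_left ?_ hu.le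
      exact mul_le_mul (mul_le_mul_of_nonneg_left h12 (abs_nonneg _)) huq (abs_nonneg _) (by positivity)
    have hden : u * u ^ 3 ≤ (u ^ 2 + p₁ ^ 2) * (u ^ 2 + p₂ ^ 2) := by
      have h1 : u ^ 2 ≤ u ^ 2 + p₁ ^ 2 := by nlinarith [sq_nonneg p₁]
      have h2 : u ^ 2 ≤ u ^ 2 + p₂ ^ 2 := by nlinarith [sq_nonneg p₂]
      calc u * u ^ 3 = u ^ 2 * u ^ 2 := by ring
        _ ≤ (u ^ 2 + p₁ ^ 2) * (u ^ 2 + p₂ ^ 2) := mul_le_mul h1 h2 (by positivity) (by positivity)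
    have hu3 : 0 < u ^ 3 := by positivity
    calc u * (|p₁ - p₂| * |p₁ + p₂| * |u + q₁|) / ((u ^ 2 + p₁ ^ 2) * (u ^ 2 + p₂ ^ 2))
        ≤ u * (|p₁ - p₂| * (|p₁| + |p₂|) * (u + |q₁|)) / ((u ^ 2 + p₁ ^ 2) * (u ^ 2 + p₂ ^ 2)) :=
          div_le_div_of_nonneg_right hnum (by positivity)
      _ ≤ u * (|p₁ - p₂| * (|p₁| + |p₂|) * (u + |q₁|)) / (u * u ^ 3) :=
          div_le_div_of_nonneg_left (by positivity) (by positivity) hden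
      _ = |p₁ - p₂| * (|p₁| + |p₂|) * (u + |q₁|) / u ^ 3 := by
          rw [mul_div_mul_left _ _ hu.ne']
  have hB : |u * (q₁ - q₂) / (u ^ 2 + p₂ ^ 2)| ≤ |q₁ - q₂| / u := by
    rw [abs_div, abs_of_pos hD2, abs_mul, abs_of_pos hu]
    have hden : u * u ≤ u ^ 2 + p₂ ^ 2 := by nlinarith [sq_nonneg p₂]
    calc u * |q₁ - q₂| / (u ^ 2 + p₂ ^ 2) ≤ u * |q₁ - q₂| / (u * u) :=
          div_le_div_of_nonneg_left (by positivity) (by positivity) hden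
      _ = |q₁ - q₂| / u := by rw [mul_div_mul_left _ _ hu.ne']
  calc _ ≤ |u * ((p₁ - p₂) * (p₁ + p₂) * (u + q₁)) / ((u ^ 2 + p₁ ^ 2) * (u ^ 2 + p₂ ^ 2))| + |u * (q₁ - q₂) / (u ^ 2 + p₂ ^ 2)| :=
        abs_sub _ _
    _ ≤ |p₁ - p₂| * (|p₁| + |p₂|) * (u + |q₁|) / u ^ 3 + |q₁ - q₂| / u := add_le_add hA hB
    _ = _ := add_comm _ _

/-! ## §2 The intrinsic lower bound: rate = curvature numerator / squared speed -/

/-- **The free band's Gauss-map rate is at least `a_min` pointwise**: `a_min ≤ α_ν′(θ)` for `ν ∈ [a, b]` — the infinitesimal form of the field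
`BandBounds.gauss` (`a_min|θ − θ′| ≤ |α(θ) − α(θ′)|`), the sign fixed by strict convexity (`bandNormalAngleDeriv_eq_hess_div`). [folklore] -/
theorem amin_le_bandNormalAngleDeriv {a b : ℝ} (B : BandBounds a b) {ν : ℝ} (hν : ν ∈ Icc a b) (θ : ℝ) :
    B.amin ≤ bandNormalAngleDeriv ν θ := by
  obtain ⟨h1, h2⟩ := B.level hν
  have hd := hasDerivAt_bandNormalAngle h1 h2 θ
  -- positivity of the rate from strict convexity
  have hpos : 0 < bandNormalAngleDeriv ν θ := by
    rw [bandNormalAngleDeriv_eq_hess_div h1 h2 θ]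
    have hh := B.hess_ge ν hν θ
    have hc := bandNormalCoeff_pos h1 h2 θ
    have hu := bandFermiRadius_pos h1 h2 θ
    have hden : 0 < bandNormalCoeff ν θ * (bandFermiRadius ν θ ^ 2 + bandFermiRadiusDeriv ν θ ^ 2) := by positivity
    exact div_pos (B.hmin_pos.trans_le hh) hden
  -- `|α′| ≥ a_min` as the limit of the expanding inequality along difference quotients
  have habs : B.amin ≤ |bandNormalAngleDeriv ν θ| := by
    have ht : Tendsto (fun t : ℝ => |t⁻¹ • (bandNormalAngle ν (θ + t) - bandNormalAngle ν θ)|) (𝓝[≠] 0)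
        (𝓝 |bandNormalAngleDeriv ν θ|) := (continuous_abs.tendsto _).comp hd.tendsto_slope_zero
    have hev : ∀ᶠ t : ℝ in 𝓝[≠] 0, B.amin ≤ |t⁻¹ • (bandNormalAngle ν (θ + t) - bandNormalAngle ν θ)| := by
      filter_upwards [self_mem_nhdsWithin] with t ht0
      have ht0' : t ≠ 0 := ht0
      have hg := B.gauss ν hν (θ + t) θ
      rw [add_sub_cancel_left] at hg
      rw [smul_eq_mul, abs_mul, abs_inv, ← div_eq_inv_mul, le_div_iff₀ (abs_pos.2 ht0')]
      exact hg
    exact ge_of_tendsto ht hev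
  rwa [abs_of_pos hpos] at habs

section Root

variable {a b : ℝ} (B : BandBounds a b) {δ : (Fin 2 → ℝ) → ℝ} (hδs : ContDiff ℝ 2 δ)
  {κ₀ κ₁ κ₂ μ : ℝ} (hδ : ∀ k : Fin 2 → ℝ, (∀ i, |k i| ≤ π) → |δ k| ≤ κ₀) (hlo : a ≤ μ - κ₀) (hhi : μ + κ₀ ≤ b)
  (hκ : ∀ k : Fin 2 → ℝ, (∀ i, |k i| ≤ π) → ‖fderiv ℝ δ k‖ ≤ κ₁) (hκ₁ : κ₁ < B.Dtmin)
  (hκ₂ : ∀ k : Fin 2 → ℝ, (∀ i, |k i| ≤ π) → ‖fderiv ℝ (fderiv ℝ δ) k‖ ≤ κ₂)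
  {u : ℝ → ℝ} (hu : ∀ θ, IsBandFermiRadius (μ - δ (u θ • dir θ)) θ (u θ))
include B hδs hδ hlo hhi hκ hκ₁ hu

/-- **`α′ = (u² + 2u′² − u u″)/(u² + u′²)`** on the perturbed curve (`α(θ) = θ − arctan(u′/u)`).
[cite: BenfattoGiulianiMastropietro2003, §7.1 (A1.10)] -/
theorem deriv_normalAngleFn_eq (θ : ℝ) :
    deriv (fun ϑ => ϑ - Real.arctan (deriv u ϑ / u ϑ)) θ =
      (u θ ^ 2 + 2 * deriv u θ ^ 2 - u θ * deriv (deriv u) θ) / (u θ ^ 2 + deriv u θ ^ 2) := by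
  have h2ne : (2 : WithTop ℕ∞) ≠ 0 := by norm_num
  have hu2 : ContDiff ℝ 2 u := contDiff_of_isRoot B hδs h2ne hδ hlo hhi hκ hκ₁ hu
  have hd1 : Differentiable ℝ u := hu2.differentiable h2ne
  have hd2 : Differentiable ℝ (deriv u) := by
    have h : ContDiff ℝ ((1 : WithTop ℕ∞) + 1) u := by rw [one_add_one_eq_two]; exact hu2
    exact ((contDiff_succ_iff_deriv.1 h).2.2).differentiable one_ne_zero
  have hupos : 0 < u θ := (mem_Ioo_of_shifted B hδ hlo hhi (hu θ)).1
  have hder := hasDerivAt_normalAngleFn hupos (hd1 θ).hasDerivAt (hd2 θ).hasDerivAt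
  rw [hder.deriv, one_sub_arctanDeriv_eq_rate hupos]

include hκ₂ in
/-- **Intrinsic Gauss-map rate**: `α′ ≥ u_min(2h_E − κ₂S_E²)/((4 + κ₁)·2S_E²)` whenever `2h_E − κ₂S_E² ≥ 0` — the polar-curvature numerator bound
`curvatureNumerator_ge` over the squared speed `u′² + u² ≤ 2S_E²` (`deriv_sq_add_sq_le`). [cite: BenfattoGiulianiMastropietro2003, §1.2 (2.8a)] -/
theorem curvRate_le_deriv_normalAngleFn (θ : ℝ)
    (hpos : 0 ≤ 2 * (B.hmin - 4 * (κ₁ * (π * Real.sqrt 2 + 2 * B.smax) / (B.Dtmin - κ₁)) *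
        ((B.smax + κ₁ * (π * Real.sqrt 2 + 2 * B.smax) / (B.Dtmin - κ₁)) + B.smax)) -
        κ₂ * (B.smax + κ₁ * (π * Real.sqrt 2 + 2 * B.smax) / (B.Dtmin - κ₁)) ^ 2) :
    B.umin * (2 * (B.hmin - 4 * (κ₁ * (π * Real.sqrt 2 + 2 * B.smax) / (B.Dtmin - κ₁)) *
        ((B.smax + κ₁ * (π * Real.sqrt 2 + 2 * B.smax) / (B.Dtmin - κ₁)) + B.smax)) -
        κ₂ * (B.smax + κ₁ * (π * Real.sqrt 2 + 2 * B.smax) / (B.Dtmin - κ₁)) ^ 2) / (4 + κ₁) /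
        (2 * (B.smax + κ₁ * (π * Real.sqrt 2 + 2 * B.smax) / (B.Dtmin - κ₁)) ^ 2) ≤
      deriv (fun ϑ => ϑ - Real.arctan (deriv u ϑ / u ϑ)) θ := by
  set SE := B.smax + κ₁ * (π * Real.sqrt 2 + 2 * B.smax) / (B.Dtmin - κ₁) with hSE
  set Nmin := B.umin * (2 * (B.hmin - 4 * (κ₁ * (π * Real.sqrt 2 + 2 * B.smax) / (B.Dtmin - κ₁)) * (SE + B.smax)) - κ₂ * SE ^ 2) /
    (4 + κ₁) with hNmin
  rw [deriv_normalAngleFn_eq B hδs hδ hlo hhi hκ hκ₁ hu θ]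
  have hsq := abs_apply_le_pi_of_isBandFermiRadius (hu θ)
  have hκ₁0 : 0 ≤ κ₁ := le_trans (norm_nonneg _) (hκ _ hsq)
  have hN := curvatureNumerator_ge B hδs hδ hlo hhi hκ hκ₁ hκ₂ hu θ hpos
  have hsp := deriv_sq_add_sq_le B hδs hδ hlo hhi hκ hκ₁ hu θ
  have hupos : 0 < u θ := (mem_Ioo_of_shifted B hδ hlo hhi (hu θ)).1
  have hD : 0 < u θ ^ 2 + deriv u θ ^ 2 := by positivity
  have hNmin0 : 0 ≤ Nmin := div_nonneg (mul_nonneg B.umin_pos.le hpos) (by linarith)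
  have hD2 : u θ ^ 2 + deriv u θ ^ 2 ≤ 2 * SE ^ 2 := by linarith
  calc Nmin / (2 * SE ^ 2) ≤ Nmin / (u θ ^ 2 + deriv u θ ^ 2) := div_le_div_of_nonneg_left hNmin0 hD hD2
    _ ≤ _ := div_le_div_of_nonneg_right hN hD.le

/-- **MVT door**: a pointwise rate bound `c ≤ α′` gives the oriented expansion `c·(θ′ − θ) ≤ α(θ′) − α(θ)` (`θ ≤ θ′`). [folklore] -/
theorem normalAngleFn_sub_ge_of_le_deriv {c : ℝ} (hc : ∀ z, c ≤ deriv (fun ϑ => ϑ - Real.arctan (deriv u ϑ / u ϑ)) z)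
    {θ θ' : ℝ} (hθ : θ ≤ θ') :
    c * (θ' - θ) ≤ (θ' - Real.arctan (deriv u θ' / u θ')) - (θ - Real.arctan (deriv u θ / u θ)) := by
  have h2ne : (2 : WithTop ℕ∞) ≠ 0 := by norm_num
  have hu2 : ContDiff ℝ 2 u := contDiff_of_isRoot B hδs h2ne hδ hlo hhi hκ hκ₁ hu
  have hd1 : Differentiable ℝ u := hu2.differentiable h2ne
  have hd2 : Differentiable ℝ (deriv u) := by
    have h : ContDiff ℝ ((1 : WithTop ℕ∞) + 1) u := by rw [one_add_one_eq_two]; exact hu2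
    exact ((contDiff_succ_iff_deriv.1 h).2.2).differentiable one_ne_zero
  have hdiff : ∀ ϑ, DifferentiableAt ℝ (fun ϑ => ϑ - Real.arctan (deriv u ϑ / u ϑ)) ϑ := fun ϑ =>
    (hasDerivAt_normalAngleFn (mem_Ioo_of_shifted B hδ hlo hhi (hu ϑ)).1 (hd1 ϑ).hasDerivAt (hd2 ϑ).hasDerivAt).differentiableAt
  exact (convex_Icc θ θ').mul_sub_le_image_sub_of_le_deriv
    (fun z _ => (hdiff z).continuousAt.continuousWithinAt)
    (fun z _ => (hdiff z).differentiableWithinAt) (fun z _ => hc z)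
    θ (left_mem_Icc.2 hθ) θ' (right_mem_Icc.2 hθ) hθ

/-- **MVT door, absolute form**: `c ≤ α′` pointwise gives `c·|θ − θ′| ≤ |α(θ) − α(θ′)|` (any sign of `c`). [folklore] -/
theorem normalAngleFn_expand_of_le_deriv {c : ℝ} (hc : ∀ z, c ≤ deriv (fun ϑ => ϑ - Real.arctan (deriv u ϑ / u ϑ)) z)
    (θ θ' : ℝ) :
    c * |θ - θ'| ≤ |(θ - Real.arctan (deriv u θ / u θ)) - (θ' - Real.arctan (deriv u θ' / u θ'))| := by
  rcases le_total θ θ' with h | h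
  · have hm := normalAngleFn_sub_ge_of_le_deriv B hδs hδ hlo hhi hκ hκ₁ hu hc h
    rw [abs_of_nonpos (sub_nonpos.2 h), abs_sub_comm]
    calc c * -(θ - θ') = c * (θ' - θ) := by ring
      _ ≤ _ := hm.trans (le_abs_self _)
  · have hm := normalAngleFn_sub_ge_of_le_deriv B hδs hδ hlo hhi hκ hκ₁ hu hc h
    rw [abs_of_nonneg (sub_nonneg.2 h)]
    exact hm.trans (le_abs_self _)

include hκ₂ in
/-- **Expanding Gauss map, intrinsic**: `a_E·|θ − θ′| ≤ |α(θ) − α(θ′)|`, `a_E = u_min(2h_E − κ₂S_E²)/((4 + κ₁)·2S_E²)` — the `BandBounds.gauss` field on the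
moving curve with the intrinsic constant (oriented form: `normalAngleFn_sub_ge_of_le_deriv` ∘ `curvRate_le_deriv_normalAngleFn`).
[cite: BenfattoGiulianiMastropietro2003, §7.1 Lemma 7.1] -/
theorem normalAngleFn_expand_curv (θ θ' : ℝ)
    (hpos : 0 ≤ 2 * (B.hmin - 4 * (κ₁ * (π * Real.sqrt 2 + 2 * B.smax) / (B.Dtmin - κ₁)) *
        ((B.smax + κ₁ * (π * Real.sqrt 2 + 2 * B.smax) / (B.Dtmin - κ₁)) + B.smax)) -
        κ₂ * (B.smax + κ₁ * (π * Real.sqrt 2 + 2 * B.smax) / (B.Dtmin - κ₁)) ^ 2) :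
    B.umin * (2 * (B.hmin - 4 * (κ₁ * (π * Real.sqrt 2 + 2 * B.smax) / (B.Dtmin - κ₁)) *
        ((B.smax + κ₁ * (π * Real.sqrt 2 + 2 * B.smax) / (B.Dtmin - κ₁)) + B.smax)) -
        κ₂ * (B.smax + κ₁ * (π * Real.sqrt 2 + 2 * B.smax) / (B.Dtmin - κ₁)) ^ 2) / (4 + κ₁) /
        (2 * (B.smax + κ₁ * (π * Real.sqrt 2 + 2 * B.smax) / (B.Dtmin - κ₁)) ^ 2) * |θ - θ'| ≤
      |(θ - Real.arctan (deriv u θ / u θ)) - (θ' - Real.arctan (deriv u θ' / u θ'))| :=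
  normalAngleFn_expand_of_le_deriv B hδs hδ hlo hhi hκ hκ₁ hu
    (fun z => curvRate_le_deriv_normalAngleFn B hδs hδ hlo hhi hκ hκ₁ hκ₂ hu z hpos) θ θ'

/-! ## §3 Closeness to the free rate at the shifted level: `α′ ≥ a_min − O(κ₁ + κ₂)` -/

include hκ₂ in
/-- **`|α_E′(θ) − α_ν′(θ)| ≤ GAP`** at the shifted level `ν = μ − δ(u(θ)·dir θ)`, `GAP = K₂/u_min + κ₁C_V(4S_E + κ₁C_V)(π√2 + U₂)/u_min³`: the two
rates are the SAME rational function of `(u, u′, u″)` resp. `(u_ν, u_ν′, u_ν″)` with `u = u_ν(θ)` (`eq_bandFermiRadius_of_shifted`), `|u′ − u_ν′| ≤ κ₁C_V`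
(`abs_deriv_sub_bandFermiRadiusDeriv_le_uniform`), `|u″ − u_ν″| ≤ K₂` (`abs_second_deriv_sub_bandRadiusDeriv2_le`); `abs_rate_sub_rate_le` does the rest.
[cite: BenfattoGiulianiMastropietro2006, §2.4 Lemma 2.1 (2.40)–(2.41)] -/
theorem abs_deriv_normalAngleFn_sub_bandNormalAngleDeriv_le (θ : ℝ) :
    |deriv (fun ϑ => ϑ - Real.arctan (deriv u ϑ / u ϑ)) θ - bandNormalAngleDeriv (μ - δ (u θ • dir θ)) θ| ≤
      (κ₁ * (4 * ((π * Real.sqrt 2 + 2 * B.smax) / (B.Dtmin - κ₁)) *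
              ((B.smax + κ₁ * (π * Real.sqrt 2 + 2 * B.smax) / (B.Dtmin - κ₁)) + B.smax) +
            8 * ((π * Real.sqrt 2 + 2 * B.smax) / (B.Dtmin - κ₁)) +
            2 * ((4 + κ₁) * (π * Real.sqrt 2) / (B.Dtmin - κ₁)) + π * Real.sqrt 2 +
            ((4 + κ₂) * (B.smax + κ₁ * (π * Real.sqrt 2 + 2 * B.smax) / (B.Dtmin - κ₁)) ^ 2 +
              (8 + 2 * κ₁) * ((4 + κ₁) * (π * Real.sqrt 2) / (B.Dtmin - κ₁)) + (4 + κ₁) * (π * Real.sqrt 2)) / (B.Dtmin - κ₁)) +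
        κ₂ * (B.smax + κ₁ * (π * Real.sqrt 2 + 2 * B.smax) / (B.Dtmin - κ₁)) ^ 2) / B.Dtmin / B.umin +
      κ₁ * (π * Real.sqrt 2 + 2 * B.smax) / (B.Dtmin - κ₁) *
        (4 * (B.smax + κ₁ * (π * Real.sqrt 2 + 2 * B.smax) / (B.Dtmin - κ₁)) + κ₁ * (π * Real.sqrt 2 + 2 * B.smax) / (B.Dtmin - κ₁)) *
        (π * Real.sqrt 2 + ((4 + κ₂) * (B.smax + κ₁ * (π * Real.sqrt 2 + 2 * B.smax) / (B.Dtmin - κ₁)) ^ 2 +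
          (8 + 2 * κ₁) * ((4 + κ₁) * (π * Real.sqrt 2) / (B.Dtmin - κ₁)) + (4 + κ₁) * (π * Real.sqrt 2)) / (B.Dtmin - κ₁)) / B.umin ^ 3 := by
  have h2ne : (2 : WithTop ℕ∞) ≠ 0 := by norm_num
  -- constants
  set CV := (π * Real.sqrt 2 + 2 * B.smax) / (B.Dtmin - κ₁) with hCV
  set SE := B.smax + κ₁ * (π * Real.sqrt 2 + 2 * B.smax) / (B.Dtmin - κ₁) with hSE
  set U1 := (4 + κ₁) * (π * Real.sqrt 2) / (B.Dtmin - κ₁) with hU1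
  set U2 := ((4 + κ₂) * SE ^ 2 + (8 + 2 * κ₁) * U1 + (4 + κ₁) * (π * Real.sqrt 2)) / (B.Dtmin - κ₁) with hU2
  set K2 := (κ₁ * (4 * CV * (SE + B.smax) + 8 * CV + 2 * U1 + π * Real.sqrt 2 + U2) + κ₂ * SE ^ 2) / B.Dtmin with hK2
  -- data at `θ`
  set ν := μ - δ (u θ • dir θ) with hν
  have hsq := abs_apply_le_pi_of_isBandFermiRadius (hu θ)
  have hκ₁0 : 0 ≤ κ₁ := le_trans (norm_nonneg _) (hκ _ hsq)
  have hden : 0 < B.Dtmin - κ₁ := sub_pos.2 hκ₁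
  have hupos : 0 < u θ := (mem_Ioo_of_shifted B hδ hlo hhi (hu θ)).1
  have humin : B.umin ≤ u θ := umin_le_of_shifted B hδ hlo hhi (hu θ)
  have hum0 := B.umin_pos
  have hur : u θ = bandFermiRadius ν θ := eq_bandFermiRadius_of_shifted B hδ hlo hhi (hu θ)
  have hule : u θ ≤ π * Real.sqrt 2 := root_le_pi_mul_sqrt_two B hδ hlo hhi hu θ
  set p₁ := deriv u θ with hp₁
  set q₁ := deriv (deriv u) θ with hq₁
  set p₂ := bandFermiRadiusDeriv ν θ with hp₂
  set q₂ := bandRadiusDeriv2 ν θ with hq₂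
  -- the closeness inputs and the a priori sizes
  have hdp : |p₁ - p₂| ≤ κ₁ * CV := by
    have h := abs_deriv_sub_bandFermiRadiusDeriv_le_uniform B hδs h2ne hδ hlo hhi hκ hκ₁ hu θ
    rw [hCV, ← mul_div_assoc]; exact h
  have hdq : |q₁ - q₂| ≤ K2 := abs_second_deriv_sub_bandRadiusDeriv2_le B hδs hδ hlo hhi hκ hκ₁ hκ₂ hu θ
  have hq1 : |q₁| ≤ U2 := abs_second_deriv_le B hδs hδ hlo hhi hκ hκ₁ hκ₂ hu θ
  have hsp := deriv_sq_add_sq_le B hδs hδ hlo hhi hκ hκ₁ hu θ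
  have hSE0 : 0 ≤ SE := by
    obtain ⟨hvx, -⟩ := abs_VXE_le B hδs h2ne hδ hlo hhi hκ hκ₁ hu θ
    exact (abs_nonneg _).trans hvx
  have hp1 : |p₁| ≤ 2 * SE := by
    refine abs_le_of_sq_le_sq ?_ (by positivity)
    nlinarith [sq_nonneg (u θ)]
  have hp2 : |p₂| ≤ 2 * SE + κ₁ * CV := by
    have : |p₂| ≤ |p₁| + |p₁ - p₂| := by
      calc |p₂| = |p₁ - (p₁ - p₂)| := by ring_nf
        _ ≤ |p₁| + |p₁ - p₂| := abs_sub _ _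
    linarith
  -- the algebraic Lipschitz estimate
  have hrate := abs_rate_sub_rate_le (p₁ := p₁) (q₁ := q₁) (p₂ := p₂) (q₂ := q₂) hupos
  have hfree : bandNormalAngleDeriv ν θ = (u θ ^ 2 + 2 * p₂ ^ 2 - u θ * q₂) / (u θ ^ 2 + p₂ ^ 2) := by
    rw [bandNormalAngleDeriv, hp₂, hq₂, ← hur]
  rw [deriv_normalAngleFn_eq B hδs hδ hlo hhi hκ hκ₁ hu θ, hfree]
  refine hrate.trans ?_
  -- bound the two terms
  have hCV0 : 0 ≤ CV := by rw [hCV]; have := B.smax_pos; positivity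
  have hK20 : 0 ≤ K2 := (abs_nonneg _).trans hdq
  have hU20 : 0 ≤ U2 := (abs_nonneg _).trans hq1
  have hT1 : |q₁ - q₂| / u θ ≤ K2 / B.umin :=
    calc |q₁ - q₂| / u θ ≤ K2 / u θ := div_le_div_of_nonneg_right hdq hupos.le
      _ ≤ K2 / B.umin := div_le_div_of_nonneg_left hK20 hum0 humin
  have hT2 : |p₁ - p₂| * (|p₁| + |p₂|) * (u θ + |q₁|) / u θ ^ 3 ≤
      κ₁ * CV * (4 * SE + κ₁ * CV) * (π * Real.sqrt 2 + U2) / B.umin ^ 3 := by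
    have hnum : |p₁ - p₂| * (|p₁| + |p₂|) * (u θ + |q₁|) ≤ κ₁ * CV * (4 * SE + κ₁ * CV) * (π * Real.sqrt 2 + U2) := by
      have h12 : |p₁| + |p₂| ≤ 4 * SE + κ₁ * CV := by linarith
      have huq : u θ + |q₁| ≤ π * Real.sqrt 2 + U2 := by linarith
      exact mul_le_mul (mul_le_mul hdp h12 (by positivity) (by positivity)) huq (by positivity) (by positivity)
    have hnum0 : 0 ≤ κ₁ * CV * (4 * SE + κ₁ * CV) * (π * Real.sqrt 2 + U2) := by positivity
    have hu3 : B.umin ^ 3 ≤ u θ ^ 3 := pow_le_pow_left₀ hum0.le humin 3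
    calc |p₁ - p₂| * (|p₁| + |p₂|) * (u θ + |q₁|) / u θ ^ 3
        ≤ κ₁ * CV * (4 * SE + κ₁ * CV) * (π * Real.sqrt 2 + U2) / u θ ^ 3 := div_le_div_of_nonneg_right hnum (by positivity)
      _ ≤ κ₁ * CV * (4 * SE + κ₁ * CV) * (π * Real.sqrt 2 + U2) / B.umin ^ 3 :=
          div_le_div_of_nonneg_left hnum0 (by positivity) hu3
  have e1 : κ₁ * (π * Real.sqrt 2 + 2 * B.smax) / (B.Dtmin - κ₁) = κ₁ * CV := by rw [hCV, mul_div_assoc]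
  rw [e1]
  exact add_le_add hT1 hT2

include hκ₂ in
/-- **`α′ ≥ a_min − GAP`** — the free Gauss-map rate of the shifted level minus the `O(κ₁ + κ₂)` closeness gap.
[cite: BenfattoGiulianiMastropietro2006, §2.4 Lemma 2.1 (2.40)–(2.41)] -/
theorem deriv_normalAngleFn_ge_amin_sub (θ : ℝ) :
    B.amin -
      ((κ₁ * (4 * ((π * Real.sqrt 2 + 2 * B.smax) / (B.Dtmin - κ₁)) *
              ((B.smax + κ₁ * (π * Real.sqrt 2 + 2 * B.smax) / (B.Dtmin - κ₁)) + B.smax) +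
            8 * ((π * Real.sqrt 2 + 2 * B.smax) / (B.Dtmin - κ₁)) +
            2 * ((4 + κ₁) * (π * Real.sqrt 2) / (B.Dtmin - κ₁)) + π * Real.sqrt 2 +
            ((4 + κ₂) * (B.smax + κ₁ * (π * Real.sqrt 2 + 2 * B.smax) / (B.Dtmin - κ₁)) ^ 2 +
              (8 + 2 * κ₁) * ((4 + κ₁) * (π * Real.sqrt 2) / (B.Dtmin - κ₁)) + (4 + κ₁) * (π * Real.sqrt 2)) / (B.Dtmin - κ₁)) +
        κ₂ * (B.smax + κ₁ * (π * Real.sqrt 2 + 2 * B.smax) / (B.Dtmin - κ₁)) ^ 2) / B.Dtmin / B.umin +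
      κ₁ * (π * Real.sqrt 2 + 2 * B.smax) / (B.Dtmin - κ₁) *
        (4 * (B.smax + κ₁ * (π * Real.sqrt 2 + 2 * B.smax) / (B.Dtmin - κ₁)) + κ₁ * (π * Real.sqrt 2 + 2 * B.smax) / (B.Dtmin - κ₁)) *
        (π * Real.sqrt 2 + ((4 + κ₂) * (B.smax + κ₁ * (π * Real.sqrt 2 + 2 * B.smax) / (B.Dtmin - κ₁)) ^ 2 +
          (8 + 2 * κ₁) * ((4 + κ₁) * (π * Real.sqrt 2) / (B.Dtmin - κ₁)) + (4 + κ₁) * (π * Real.sqrt 2)) / (B.Dtmin - κ₁)) / B.umin ^ 3) ≤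
      deriv (fun ϑ => ϑ - Real.arctan (deriv u ϑ / u ϑ)) θ := by
  have hm := shiftedLevel_mem_Icc (hu θ) hδ hlo hhi
  have hfree := amin_le_bandNormalAngleDeriv B hm θ
  have hgap := abs_deriv_normalAngleFn_sub_bandNormalAngleDeriv_le B hδs hδ hlo hhi hκ hκ₁ hκ₂ hu θ
  have h := (abs_le.1 hgap).1
  linarith

include hκ₂ in
/-- **Expanding Gauss map on the moving curve** — the `BandBounds.gauss` field for the perturbed curve: `(a_min − GAP)·|θ − θ′| ≤ |α(θ) − α(θ′)|`
(trivial when `a_min ≤ GAP`; oriented form via `normalAngleFn_sub_ge_of_le_deriv`). [cite: BenfattoGiulianiMastropietro2003, §7.1 Lemma 7.1 (A1.9)] -/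
theorem normalAngleFn_expand (θ θ' : ℝ) :
    (B.amin -
      ((κ₁ * (4 * ((π * Real.sqrt 2 + 2 * B.smax) / (B.Dtmin - κ₁)) *
              ((B.smax + κ₁ * (π * Real.sqrt 2 + 2 * B.smax) / (B.Dtmin - κ₁)) + B.smax) +
            8 * ((π * Real.sqrt 2 + 2 * B.smax) / (B.Dtmin - κ₁)) +
            2 * ((4 + κ₁) * (π * Real.sqrt 2) / (B.Dtmin - κ₁)) + π * Real.sqrt 2 +
            ((4 + κ₂) * (B.smax + κ₁ * (π * Real.sqrt 2 + 2 * B.smax) / (B.Dtmin - κ₁)) ^ 2 +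
              (8 + 2 * κ₁) * ((4 + κ₁) * (π * Real.sqrt 2) / (B.Dtmin - κ₁)) + (4 + κ₁) * (π * Real.sqrt 2)) / (B.Dtmin - κ₁)) +
        κ₂ * (B.smax + κ₁ * (π * Real.sqrt 2 + 2 * B.smax) / (B.Dtmin - κ₁)) ^ 2) / B.Dtmin / B.umin +
      κ₁ * (π * Real.sqrt 2 + 2 * B.smax) / (B.Dtmin - κ₁) *
        (4 * (B.smax + κ₁ * (π * Real.sqrt 2 + 2 * B.smax) / (B.Dtmin - κ₁)) + κ₁ * (π * Real.sqrt 2 + 2 * B.smax) / (B.Dtmin - κ₁)) *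
        (π * Real.sqrt 2 + ((4 + κ₂) * (B.smax + κ₁ * (π * Real.sqrt 2 + 2 * B.smax) / (B.Dtmin - κ₁)) ^ 2 +
          (8 + 2 * κ₁) * ((4 + κ₁) * (π * Real.sqrt 2) / (B.Dtmin - κ₁)) + (4 + κ₁) * (π * Real.sqrt 2)) / (B.Dtmin - κ₁)) / B.umin ^ 3)) *
        |θ - θ'| ≤
      |(θ - Real.arctan (deriv u θ / u θ)) - (θ' - Real.arctan (deriv u θ' / u θ'))| :=
  normalAngleFn_expand_of_le_deriv B hδs hδ hlo hhi hκ hκ₁ hu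
    (fun z => deriv_normalAngleFn_ge_amin_sub B hδs hδ hlo hhi hκ hκ₁ hκ₂ hu z) θ θ'

end Root

/-! ## §4 In BGM 2003's chart vocabulary for `u := perturbedFermiRadius δ μ` -/

section Chart

variable {a b : ℝ} (B : BandBounds a b) {δ : (Fin 2 → ℝ) → ℝ} (hδs : ContDiff ℝ 2 δ)
  {κ₀ κ₁ κ₂ μ : ℝ} (hδ : ∀ k : Fin 2 → ℝ, (∀ i, |k i| ≤ π) → |δ k| ≤ κ₀) (hlo : a ≤ μ - κ₀) (hhi : μ + κ₀ ≤ b)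
  (hκ : ∀ k : Fin 2 → ℝ, (∀ i, |k i| ≤ π) → ‖fderiv ℝ δ k‖ ≤ κ₁) (hκ₁ : κ₁ < B.Dtmin)
  (hκ₂ : ∀ k : Fin 2 → ℝ, (∀ i, |k i| ≤ π) → ‖fderiv ℝ (fderiv ℝ δ) k‖ ≤ κ₂)
include B hδs hδ hlo hhi hκ hκ₁ hκ₂

/-- **(u2), expanding half**: `(a_min − GAP)·|θ₂ − θ₁| ≤ |α(θ₂, 0) − α(θ₁, 0)|` for the chart `u₂ θ e := perturbedFermiRadius δ (μ + e) θ` of the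
perturbed curve — companion of `normalAngle_perturbed_lipschitz`. [cite: BenfattoGiulianiMastropietro2003, §7.1 Lemma 7.1 (A1.9)] -/
theorem normalAngle_perturbed_expand (θ₁ θ₂ : ℝ) :
    (B.amin -
      ((κ₁ * (4 * ((π * Real.sqrt 2 + 2 * B.smax) / (B.Dtmin - κ₁)) *
              ((B.smax + κ₁ * (π * Real.sqrt 2 + 2 * B.smax) / (B.Dtmin - κ₁)) + B.smax) +
            8 * ((π * Real.sqrt 2 + 2 * B.smax) / (B.Dtmin - κ₁)) +
            2 * ((4 + κ₁) * (π * Real.sqrt 2) / (B.Dtmin - κ₁)) + π * Real.sqrt 2 +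
            ((4 + κ₂) * (B.smax + κ₁ * (π * Real.sqrt 2 + 2 * B.smax) / (B.Dtmin - κ₁)) ^ 2 +
              (8 + 2 * κ₁) * ((4 + κ₁) * (π * Real.sqrt 2) / (B.Dtmin - κ₁)) + (4 + κ₁) * (π * Real.sqrt 2)) / (B.Dtmin - κ₁)) +
        κ₂ * (B.smax + κ₁ * (π * Real.sqrt 2 + 2 * B.smax) / (B.Dtmin - κ₁)) ^ 2) / B.Dtmin / B.umin +
      κ₁ * (π * Real.sqrt 2 + 2 * B.smax) / (B.Dtmin - κ₁) *
        (4 * (B.smax + κ₁ * (π * Real.sqrt 2 + 2 * B.smax) / (B.Dtmin - κ₁)) + κ₁ * (π * Real.sqrt 2 + 2 * B.smax) / (B.Dtmin - κ₁)) *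
        (π * Real.sqrt 2 + ((4 + κ₂) * (B.smax + κ₁ * (π * Real.sqrt 2 + 2 * B.smax) / (B.Dtmin - κ₁)) ^ 2 +
          (8 + 2 * κ₁) * ((4 + κ₁) * (π * Real.sqrt 2) / (B.Dtmin - κ₁)) + (4 + κ₁) * (π * Real.sqrt 2)) / (B.Dtmin - κ₁)) / B.umin ^ 3)) *
        |θ₂ - θ₁| ≤
      |BGM2003.normalAngle (fun ϑ e => perturbedFermiRadius δ (μ + e) ϑ) θ₂ 0 -
        BGM2003.normalAngle (fun ϑ e => perturbedFermiRadius δ (μ + e) ϑ) θ₁ 0| := by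
  rw [normalAngle_perturbed_eq, normalAngle_perturbed_eq]
  have hu : ∀ θ, IsBandFermiRadius (μ - δ (perturbedFermiRadius δ μ θ • dir θ)) θ (perturbedFermiRadius δ μ θ) :=
    isBandFermiRadius_perturbedFermiRadius B hδs.continuous hδ hlo hhi
  exact normalAngleFn_expand B hδs hδ hlo hhi hκ hκ₁ hκ₂ hu θ₂ θ₁

end Chart

end Summit.HubbardSuperconductivity.HubbardSuperconductivity.Theorems.PerturbedFermiCurve

end
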